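import Summits.KontsevichZagierPeriods.KontsevichZagierPeriods.Theorems.SymplecticScissorsTypeAGenerationStubDlogOfUnitInterpolant
import Summits.KontsevichZagierPeriods.KontsevichZagierPeriods.Theorems.SymplecticScissorsTypeAGenerationStubWeightedNormMul
import Summits.KontsevichZagierPeriods.KontsevichZagierPeriods.Theorems.SymplecticScissorsTypeAGenerationStubGeometricMajorant
import Summits.KontsevichZagierPeriods.KontsevichZagierPeriods.Theorems.SymplecticScissorsTypeAGenerationStubUnitOfSmallDeviation

/-!
# `TypeAGeneration` (stmt-KontsevichZagierPeriods-18392), line `Sketch`: the dlog of every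
SMALL-DEVIATION loop is type (a) (registered stub `stub_dlogOfSmallDeviation`, lead assembly of wave 3)

Second sector theorem INSIDE the residual of the line `Sketch` (card stokes-compiler, engine (C2)
with ADMISSIBILITY MADE ALGEBRAIC). Wave 3 landed the weighted-`ℓ¹` calculus of Ayoub's algebra:
U0 `stub_weightedNormMul` (p150756: `N_ρ(FG) ≤ N_ρ(F) N_ρ(G)`), U1a `stub_geometricMajorant_of`
(p150976: `Σ ψ^m` converges in `N_ρ` when `N_ρ(ψ) < 1`), U1b `stub_unitOfSmallDeviation_of`
(p150916: the straight-line interpolant `W̃ = W₀ + z_j (W − W₀)` of `W ∈ 𝒪_{k-alg}(𝔻̄^∞)` whose face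
`W₀ = W|_{zᵢ=0}` is a unit with inverse `U` and whose deviation `D = (W − W₀) U` has
`ρ_j N_ρ(D) < 1` is a unit of `𝒪_{k-alg}(𝔻̄^∞)`). Together with the interpolation certificate A2
`stub_dlogOfUnitInterpolant` this gives: **for every loop `W` (`W|_{zᵢ=1} = W|_{zᵢ=0}`) with small
deviation from its `zᵢ = 0` face, `W′/W` lies in the `k`-span of type (a)** — a sufficient,
checkable (weighted-norm) admissibility criterion replacing "zero-free on the closed polydisc".
What it does NOT cover (the residual's arithmetic): loops with large deviation, e.g. the
logarithmic derivative of `Π (z − αⱼ)^{eⱼ}` for an exact relation `Π (1 − 1/αⱼ)^{eⱼ} = 1`; the next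
rung is the `N`-th-root contraction `W^{1/N}` (deviation `→ 0`), cf. crux 18116's
`ExactDlogRelationInSpan`. [Ayoub 2015 Rem. 1.2, Rem. 1.5]
-/

noncomputable section

-- `Summit.KontsevichZagierPeriods.KontsevichZagierPeriods.…` is the tree's mandated layout (single-conjunct summit).
set_option linter.dupNamespace false

namespace Summit.KontsevichZagierPeriods.KontsevichZagierPeriods.TypeAGenerationLine

open Finsupp MvPowerSeries
open Literature.NumberTheory.Transcendental
open Literature.NumberTheory.Transcendental.AyoubRel
open Summit.KontsevichZagierPeriods.KontsevichZagierPeriods.Theses.SymplecticScissors (TypeAGeneration)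

/-- **Registered stub `stub_dlogOfSmallDeviation` — dlog of a small-deviation loop is type (a).**
For `W ∈ 𝒪_{k-alg}(𝔻̄^∞)` free of `z_j` (`i ≠ j`) with `W|_{zᵢ=1} = W|_{zᵢ=0}`, `U ∈ 𝒪_{k-alg}(𝔻̄^∞)`
with `W|_{zᵢ=0} · U = 1` and weights `ρ > 1`, and deviation `ρ_j · N_ρ((W − W|_{zᵢ=0}) U) < 1`:
`∂ᵢW · (W̃⁻¹)|_{z_j=1} ∈ ⟨a⟩_k`, `W̃ = W|_{zᵢ=0} + z_j (W − W|_{zᵢ=0})` (so `(W̃⁻¹)|_{z_j=1} = 1/W`).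
Assembly: U1b (fed with U0, U1a) makes `W̃` a unit of `𝒪_{k-alg}(𝔻̄^∞)`; A2 is the certificate.
[cite: Ayoub2015, Rem. 1.5] -/
theorem stub_dlogOfSmallDeviation :
    ∀ (k : Type) [Field k] [CharZero k] (σ : k →+* ℂ) (i j : ℕ), i ≠ j →
      ∀ (W U : CSeries), W ∈ Oan σ → U ∈ Oan σ → ¬ UsesVar W j → restrC i 1 W = restrC i 0 W →
        restrC i 0 W * U = 1 →
      ∀ (ρ : ℕ → ℝ), (∀ l, 1 < ρ l) →
        Summable (fun a : ℕ →₀ ℕ => ‖MvPowerSeries.coeff a U‖ * a.prod fun l n => ρ l ^ n) →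
        ∀ (S : ℝ),
          HasSum (fun a : ℕ →₀ ℕ => ‖MvPowerSeries.coeff a ((W - restrC i 0 W) * U)‖ * a.prod fun l n => ρ l ^ n) S →
          ρ j * S < 1 →
          pdz i W * restrC j 1 (restrC i 0 W + X j * (W - restrC i 0 W))⁻¹ ∈
            kSpan σ {x : CSeries | ∃ G ∈ Oan σ, ∃ n : ℕ, x = relAC n G} := by
  intro k _ _ σ i j hij W U hW hU hWj hface hWU ρ hρ hUs S hS hsmall
  obtain ⟨hV, hunit, -⟩ := stub_unitOfSmallDeviation_of stub_weightedNormMul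
    (stub_geometricMajorant_of stub_weightedNormMul) k σ i j hij W U hW hU hWU ρ hρ hUs S hS hsmall
  exact stub_dlogOfUnitInterpolant k σ i j hij W _ hW hV hWj hunit hface

end Summit.KontsevichZagierPeriods.KontsevichZagierPeriods.TypeAGenerationLine
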